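import Summits.Parity.GeneralizedHardyLittlewood.Theses.LiouvilleShiftedTables
import Summits.Parity.GeneralizedHardyLittlewood.Theorems.DilatedTableChowla.Negative.DilatedTableChowlaLargeDilations
import Summits.Parity.GeneralizedHardyLittlewood.Theorems.DilatedTableChowla.Negative.DilatedTableChowlaPointwise
import Summits.Parity.GeneralizedHardyLittlewood.Theorems.DilatedTableChowla.Negative.DilatedTableChowlaLoadBearing

/-!
# `LargeDilatedTableChowla` (stmt-Parity-14839): the large-dilation band of X1 — exact strength

Support file for the item `LiouvilleShiftedTables.LargeDilatedTableChowla` (route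
LiouvilleShiftedTables, support r9): for every `c ≠ 0`, `0 < δ ≤ 1/12`, `C > 0` there are `K`, `x₀`
with `Σ_{(log x)^K < q ≤ x^{δ/2}} q³ · F(q, u q, v q) ≤ x²/(log x)^C` for `x ≥ x₀`, uniformly in the
window `x^δ ≤ A ≤ x^{1/3+δ}` and in the class functions `u v` (notation `F`, `lhs`, `rows`, `cols`
of `Theorems/DilatedTableChowla/Negative/DilatedTableChowlaBlocks`).

Kernel-checked facts about the SIZE of the item (its two-point content is an open problem; these
lemmas pin down exactly what it is equivalent to and what it buys):

* `item_iff_band` — read-back in the factored notation (`Iff.rfl`).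
* `of_dilatedTableChowla` — the crux X1 implies the item (sub-sum of non-negative terms).
* `band_anti`, `exists_threshold_ge` — the band sum is antitone in the threshold exponent `K`
  (for `log x ≥ 1`), so the item supplies thresholds `K ≥ K₀` for any `K₀`.
* `of_largeDilations` — the disprover's fixed-threshold band statement
  `Negative.LargeDilations B` (any real `B`) implies the item (`K = ⌈B⌉₊`).
* `small_dilations_le` — positivity: the dilations `q ≤ (log x)^K` cost at most
  `(log x)^{4K} · F(1,0,0)` (every block is a sub-table, `Negative.F_le_table`).
* `dilatedTableChowla_of_table_of_item`, `dilatedTableChowla_iff_table_and_item` —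
  **`DilatedTableChowla ↔ TableChowla ∧ LargeDilatedTableChowla`**: the item is EXACTLY the residual
  of the crux X1 (stmt-Parity-14271) beyond its rank-2 sibling `TableChowla` (stmt-Parity-14270);
  the `←` direction is the route's glue `TableToDilated` (stmt-Parity-14840).
* Companion file `LiouvilleShiftedTablesLargeDilatedTableChowlaPointwise`: the PROVER INTERFACE
  `item_iff_bandPointwise` (the item ↔ the pointwise block bound `q⁴F ≤ x²/(log x)^C` for the band
  dilations off a prover-chosen exceptional set of harmonic mass `≤ (log x)^{-C}`).

[folklore]
-/

namespace Summit.Parity.GeneralizedHardyLittlewood.Theorems.LargeDilatedTableChowla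

open Finset
open Summit.Parity.GeneralizedHardyLittlewood.Theses.LiouvilleShiftedTables
open Summit.Parity.GeneralizedHardyLittlewood.Theorems.DilatedTableChowla.Negative

/-! ### Read-back and monotonicity -/

/-- READ-BACK of the item in the factored notation of `DilatedTableChowlaBlocks`
(`F c x A q u v = Σ_{a,a' ∈ rows A q u} S(a,a')²`, `S(a,a') = Σ_{b ∈ cols x A q v} λ(ab+c)λ(a'b+c)`):
definitional. [folklore] -/
theorem item_iff_band : LargeDilatedTableChowla ↔
    ∀ c : ℤ, c ≠ 0 → ∀ δ : ℝ, 0 < δ → δ ≤ 1 / 12 → ∀ C : ℝ, 0 < C → ∃ K : ℕ, ∃ x₀ : ℝ,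
      ∀ x : ℝ, x₀ ≤ x → ∀ A : ℝ, x ^ δ ≤ A → A ≤ x ^ (1 / 3 + δ) → ∀ u v : ℕ → ℕ,
        (∑ q ∈ Finset.Ioc ⌊Real.log x ^ K⌋₊ ⌊x ^ (δ / 2)⌋₊, (q : ℝ) ^ 3 * F c x A q (u q) (v q))
          ≤ x ^ 2 / Real.log x ^ C :=
  Iff.rfl

/-- The band `(⌊(log x)^K⌋, ⌊x^{δ/2}⌋]` is a sub-range of the crux's `[1, ⌊x^{δ/2}⌋]`, and all terms
are non-negative: the band sum is at most the crux's left-hand side. [folklore] -/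
theorem band_le_lhs (c : ℤ) (δ x A : ℝ) (K : ℕ) (u v : ℕ → ℕ) :
    (∑ q ∈ Finset.Ioc ⌊Real.log x ^ K⌋₊ ⌊x ^ (δ / 2)⌋₊, (q : ℝ) ^ 3 * F c x A q (u q) (v q))
      ≤ lhs c δ x A u v := by
  unfold lhs
  refine Finset.sum_le_sum_of_subset_of_nonneg ?_ fun q _ _ => term_nonneg c x A q (u q) (v q)
  intro q hq
  rw [Finset.mem_Ioc] at hq
  exact Finset.mem_Icc.2 ⟨by omega, hq.2⟩

/-- **The crux X1 implies the item** (`DilatedTableChowla → LargeDilatedTableChowla`): drop the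
non-negative terms `q ≤ (log x)^K` (any `K`; here `K = 0`). [folklore] -/
theorem of_dilatedTableChowla (h : DilatedTableChowla) : LargeDilatedTableChowla := by
  rw [crux_iff_lhs] at h
  intro c hc δ hδ hδ' C hC
  obtain ⟨x₀, hx₀⟩ := h c hc δ hδ hδ' C hC
  exact ⟨0, x₀, fun x hx A hA1 hA2 u v =>
    (band_le_lhs c δ x A 0 u v).trans (hx₀ x hx A hA1 hA2 u v)⟩

/-- The band sum is ANTITONE in the threshold exponent: for `log x ≥ 1` and `K ≤ K'` the band above
`(log x)^{K'}` is contained in the band above `(log x)^K`. [folklore] -/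
theorem band_anti {x : ℝ} (hx : 1 ≤ Real.log x) {K K' : ℕ} (hK : K ≤ K') (c : ℤ) (δ A : ℝ)
    (u v : ℕ → ℕ) :
    (∑ q ∈ Finset.Ioc ⌊Real.log x ^ K'⌋₊ ⌊x ^ (δ / 2)⌋₊, (q : ℝ) ^ 3 * F c x A q (u q) (v q))
      ≤ ∑ q ∈ Finset.Ioc ⌊Real.log x ^ K⌋₊ ⌊x ^ (δ / 2)⌋₊, (q : ℝ) ^ 3 * F c x A q (u q) (v q) := by
  refine Finset.sum_le_sum_of_subset_of_nonneg ?_ fun q _ _ => term_nonneg c x A q (u q) (v q)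
  apply Finset.Ioc_subset_Ioc_left
  exact Nat.floor_le_floor (pow_le_pow_right₀ hx hK)

/-- The item supplies thresholds `K ≥ K₀` for every `K₀` (a larger `K` only drops non-negative
terms, once `log x ≥ 1`). [folklore] -/
theorem exists_threshold_ge (h : LargeDilatedTableChowla) {c : ℤ} (hc : c ≠ 0) {δ : ℝ}
    (hδ : 0 < δ) (hδ' : δ ≤ 1 / 12) {C : ℝ} (hC : 0 < C) (K₀ : ℕ) :
    ∃ K : ℕ, K₀ ≤ K ∧ ∃ x₀ : ℝ, ∀ x : ℝ, x₀ ≤ x → ∀ A : ℝ, x ^ δ ≤ A → A ≤ x ^ (1 / 3 + δ) →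
      ∀ u v : ℕ → ℕ,
        (∑ q ∈ Finset.Ioc ⌊Real.log x ^ K⌋₊ ⌊x ^ (δ / 2)⌋₊, (q : ℝ) ^ 3 * F c x A q (u q) (v q))
          ≤ x ^ 2 / Real.log x ^ C := by
  obtain ⟨K, x₀, hx₀⟩ := h c hc δ hδ hδ' C hC
  refine ⟨max K K₀, le_max_right _ _, max x₀ (Real.exp 1), fun x hx A hA1 hA2 u v => ?_⟩
  have hx0 : x₀ ≤ x := (le_max_left _ _).trans hx
  have hxe : Real.exp 1 ≤ x := (le_max_right _ _).trans hx
  have hL1 : (1 : ℝ) ≤ Real.log x := (Real.le_log_iff_exp_le ((Real.exp_pos 1).trans_le hxe)).2 hxe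
  exact (band_anti hL1 (le_max_left K K₀) c δ A u v).trans (hx₀ x hx0 A hA1 hA2 u v)

/-- The disprover's fixed-threshold band statement implies the item:
`Negative.LargeDilations B → LargeDilatedTableChowla` for every real `B` (take `K = ⌈B⌉₊`: for
`log x ≥ 1` every `q > ⌊(log x)^K⌋` has `(log x)^B ≤ (log x)^K < q`). [folklore] -/
theorem of_largeDilations {B : ℝ} (h : LargeDilations B) : LargeDilatedTableChowla := by
  intro c hc δ hδ hδ' C hC
  obtain ⟨x₀, hx₀⟩ := h c hc δ hδ hδ' C hC
  refine ⟨⌈B⌉₊, max x₀ (Real.exp 1), fun x hx A hA1 hA2 u v => ?_⟩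
  have hx0 : x₀ ≤ x := (le_max_left _ _).trans hx
  have hxe : Real.exp 1 ≤ x := (le_max_right _ _).trans hx
  have hL1 : (1 : ℝ) ≤ Real.log x := (Real.le_log_iff_exp_le ((Real.exp_pos 1).trans_le hxe)).2 hxe
  have hL0 : 0 ≤ Real.log x := by linarith
  refine le_trans ?_ (hx₀ x hx0 A hA1 hA2 u v)
  refine Finset.sum_le_sum_of_subset_of_nonneg ?_ fun q _ _ => term_nonneg c x A q (u q) (v q)
  intro q hq
  rw [Finset.mem_Ioc] at hq
  refine Finset.mem_filter.2 ⟨Finset.mem_Icc.2 ⟨by omega, hq.2⟩, ?_⟩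
  have h1 : Real.log x ^ B ≤ Real.log x ^ (⌈B⌉₊ : ℕ) := by
    rw [← Real.rpow_natCast]
    exact Real.rpow_le_rpow_of_exponent_le hL1 (Nat.le_ceil B)
  have h2 : Real.log x ^ (⌈B⌉₊ : ℕ) < (q : ℝ) := (Nat.floor_lt (pow_nonneg hL0 _)).1 hq.1
  exact h1.trans_lt h2

/-! ### The item is the residual of X1 beyond `TableChowla` -/

/-- POSITIVITY (lever (P)): for every natural `K` and `log x ≥ 0`, the dilations `q ≤ (log x)^K`
cost at most `(log x)^{4K} · F(1,0,0)` — every block is entrywise a sub-table of the `q = 1` table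
(`Negative.F_le_table`), and there are at most `(log x)^K` of them, each weighted `q³ ≤ (log x)^{3K}`.
[folklore] -/
theorem small_dilations_le (c : ℤ) {x : ℝ} (hx : 0 ≤ Real.log x) (A : ℝ) (K : ℕ) (u v : ℕ → ℕ) :
    (∑ q ∈ Finset.Icc 1 ⌊Real.log x ^ K⌋₊, (q : ℝ) ^ 3 * F c x A q (u q) (v q))
      ≤ Real.log x ^ (4 * K) * F c x A 1 0 0 := by
  have hLK : 0 ≤ Real.log x ^ K := pow_nonneg hx K
  have hm : ((⌊Real.log x ^ K⌋₊ : ℕ) : ℝ) ≤ Real.log x ^ K := Nat.floor_le hLK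
  have hF1 : 0 ≤ F c x A 1 0 0 := F_nonneg c x A 1 0 0
  have h0 : 0 ≤ (Real.log x ^ K) ^ 3 * F c x A 1 0 0 := mul_nonneg (pow_nonneg hLK 3) hF1
  calc (∑ q ∈ Finset.Icc 1 ⌊Real.log x ^ K⌋₊, (q : ℝ) ^ 3 * F c x A q (u q) (v q))
      ≤ ∑ q ∈ Finset.Icc 1 ⌊Real.log x ^ K⌋₊, (Real.log x ^ K) ^ 3 * F c x A 1 0 0 := by
        refine Finset.sum_le_sum fun q hq => ?_
        have hqm : (q : ℝ) ≤ Real.log x ^ K :=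
          le_trans (by exact_mod_cast (Finset.mem_Icc.1 hq).2) hm
        exact mul_le_mul (pow_le_pow_left₀ (Nat.cast_nonneg q) hqm 3)
          (F_le_table c x A q (u q) (v q)) (F_nonneg c x A q (u q) (v q)) (pow_nonneg hLK 3)
    _ = ((⌊Real.log x ^ K⌋₊ : ℕ) : ℝ) * ((Real.log x ^ K) ^ 3 * F c x A 1 0 0) := by
        rw [Finset.sum_const, Nat.card_Icc, Nat.add_sub_cancel, nsmul_eq_mul]
    _ ≤ Real.log x ^ K * ((Real.log x ^ K) ^ 3 * F c x A 1 0 0) :=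
        mul_le_mul_of_nonneg_right hm h0
    _ = Real.log x ^ (4 * K) * F c x A 1 0 0 := by ring

/-- **`TableChowla → LargeDilatedTableChowla → DilatedTableChowla`** (the route's glue
`TableToDilated`, stmt-Parity-14840, as a lemma): given `(c,δ,C)` take `K, x₂` from the item at
exponent `C+1` and `x₁` from `TableChowla` at exponent `C+1+4K`; for `x ≥ max x₁ x₂ (exp 2)` split
`[1, x^{δ/2}] ⊆ [1, (log x)^K] ∪ ((log x)^K, x^{δ/2}]`: the small dilations cost
`(log x)^{4K} F(1) ≤ x²/(log x)^{C+1}` (`small_dilations_le`), the band costs `x²/(log x)^{C+1}`, and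
`2 x²/(log x)^{C+1} ≤ x²/(log x)^C`. [folklore] -/
theorem dilatedTableChowla_of_table_of_item (hT : TableChowla) (hL : LargeDilatedTableChowla) :
    DilatedTableChowla := by
  rw [crux_iff_lhs]
  intro c hc δ hδ hδ' C hC
  obtain ⟨K, x₂, hx₂⟩ := hL c hc δ hδ hδ' (C + 1) (by linarith)
  obtain ⟨x₁, hx₁⟩ := hT c hc δ hδ hδ' (C + 1 + 4 * K) (by positivity)
  refine ⟨max (max x₁ x₂) (Real.exp 2), fun x hx A hA1 hA2 u v => ?_⟩
  have hx1 : x₁ ≤ x := le_trans (le_trans (le_max_left _ _) (le_max_left _ _)) hx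
  have hx2 : x₂ ≤ x := le_trans (le_trans (le_max_right _ _) (le_max_left _ _)) hx
  have hxe : Real.exp 2 ≤ x := le_trans (le_max_right _ _) hx
  have hlog2 : (2 : ℝ) ≤ Real.log x := (Real.le_log_iff_exp_le ((Real.exp_pos 2).trans_le hxe)).2 hxe
  have hlogpos : 0 < Real.log x := by linarith
  have hLC : 0 < Real.log x ^ C := Real.rpow_pos_of_pos hlogpos C
  have hLC1 : 0 < Real.log x ^ (C + 1) := Real.rpow_pos_of_pos hlogpos _
  -- the two inputs
  have htable : F c x A 1 0 0 ≤ x ^ 2 / Real.log x ^ (C + 1 + 4 * K) := by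
    rw [F_one_eq_table]; exact hx₁ x hx1 A hA1 hA2
  have hband := hx₂ x hx2 A hA1 hA2 u v
  -- split the dilation range
  set Q : ℕ := ⌊x ^ (δ / 2)⌋₊ with hQ
  set m : ℕ := ⌊Real.log x ^ K⌋₊ with hm
  have hsub : Finset.Icc 1 Q ⊆ Finset.Icc 1 m ∪ Finset.Ioc m Q := by
    intro q hq
    rw [Finset.mem_Icc] at hq
    rw [Finset.mem_union, Finset.mem_Icc, Finset.mem_Ioc]
    omega
  have hdisj : Disjoint (Finset.Icc 1 m) (Finset.Ioc m Q) := by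
    rw [Finset.disjoint_left]
    intro q h1 h2
    rw [Finset.mem_Icc] at h1
    rw [Finset.mem_Ioc] at h2
    omega
  have hsmall : (∑ q ∈ Finset.Icc 1 m, (q : ℝ) ^ 3 * F c x A q (u q) (v q))
      ≤ x ^ 2 / Real.log x ^ (C + 1) := by
    refine (small_dilations_le c hlogpos.le A K u v).trans ?_
    have hpow : Real.log x ^ (C + 1 + 4 * K) = Real.log x ^ (C + 1) * Real.log x ^ (4 * K) := by
      rw [Real.rpow_add hlogpos, ← Real.rpow_natCast]
      push_cast
      ring_nf
    have h4K : 0 < Real.log x ^ (4 * K) := pow_pos hlogpos _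
    calc Real.log x ^ (4 * K) * F c x A 1 0 0
        ≤ Real.log x ^ (4 * K) * (x ^ 2 / Real.log x ^ (C + 1 + 4 * K)) := by gcongr
      _ = x ^ 2 / Real.log x ^ (C + 1) := by
          rw [hpow]; field_simp
  have hhalf : x ^ 2 / Real.log x ^ (C + 1) ≤ x ^ 2 / Real.log x ^ C / 2 := by
    rw [Real.rpow_add_one hlogpos.ne' C, div_div, div_le_div_iff₀ (by positivity) (by positivity)]
    have : x ^ 2 * (Real.log x ^ C * 2) ≤ x ^ 2 * (Real.log x ^ C * Real.log x) := by gcongr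
    linarith
  calc lhs c δ x A u v
      ≤ ∑ q ∈ Finset.Icc 1 m ∪ Finset.Ioc m Q, (q : ℝ) ^ 3 * F c x A q (u q) (v q) := by
        unfold lhs
        rw [← hQ]
        exact Finset.sum_le_sum_of_subset_of_nonneg hsub fun q _ _ => term_nonneg c x A q (u q) (v q)
    _ = (∑ q ∈ Finset.Icc 1 m, (q : ℝ) ^ 3 * F c x A q (u q) (v q)) +
          ∑ q ∈ Finset.Ioc m Q, (q : ℝ) ^ 3 * F c x A q (u q) (v q) := Finset.sum_union hdisj
    _ ≤ x ^ 2 / Real.log x ^ (C + 1) + x ^ 2 / Real.log x ^ (C + 1) := add_le_add hsmall hband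
    _ ≤ x ^ 2 / Real.log x ^ C := by linarith

/-- **`DilatedTableChowla ↔ TableChowla ∧ LargeDilatedTableChowla`**: the item is EXACTLY the
residual content of the crux X1 (stmt-Parity-14271) beyond its rank-2 sibling `TableChowla`
(stmt-Parity-14270). (`→`: `Negative.crux_imp_tableChowla` and `of_dilatedTableChowla`; `←`:
`dilatedTableChowla_of_table_of_item`.) [folklore] -/
theorem dilatedTableChowla_iff_table_and_item :
    DilatedTableChowla ↔ TableChowla ∧ LargeDilatedTableChowla :=
  ⟨fun h => ⟨crux_imp_tableChowla h, of_dilatedTableChowla h⟩,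
    fun h => dilatedTableChowla_of_table_of_item h.1 h.2⟩

end Summit.Parity.GeneralizedHardyLittlewood.Theorems.LargeDilatedTableChowla
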